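import Summits.ResolutionOfSingularities.ResolutionOfSingularities.Theorems.PrimaryDeepKernels
import Literature.AlgebraicGeometry.Resolution.PowerSeriesRegularLocal
import HarnessLib

/-!
# Primary deep cut — ROOT (lens-4 g47, node «PrimaryDeepCut», slice S7)

§1 the exact carves (zero binders): `DeepSurfaceLaw n ⟺ NonPrimaryDeepSurfaceLaw n`, `DeepContactLaw n ⟺
NonPrimaryDeepContactLaw n`, their `All` versions, chained to `MaxContactCut.SurfaceLawAll` / `MaxContactCut.NoContactHuggingTowers`
through the g46 carves; §2 the ring-level NON-THINNESS WITNESS: the family `𝓘_N = (X₀^ℓ·X₃^e + X₁^ℓ·X₂^N, X₁^ℓ·X₃^e)` in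
`k⟦X₀,…,X₃⟧` satisfies every letter clause of `PrimaryDeepSurfaceHugging` at ring level (primary shadow `(X₀,X₁,X₃^e,X₂^N)`
of unbounded colength `N·e`, surface order exactly `e`) and is NOT submaximal (`𝓘_N ⊄ 𝔭^(n-1)`, `n = ℓ + e`, `e ≥ 2`);
§3 FQ controls.  The tree root `noForcedTowers_of_g48` is untouched.
-/

set_option linter.dupNamespace false

open CategoryTheory CategoryTheory.Limits AlgebraicGeometry TopologicalSpace IsLocalRing
open MvPolynomial Literature.AlgebraicGeometry.Resolution Scheme.IdealSheafData
open Summit.ResolutionOfSingularities.ResolutionOfSingularities.Theorems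
open ForcedTowerClasses DivergentTowerClasses MonomialTowerClasses
open HugDimensionClasses SurfaceShadowClasses SurfaceShadowKernels AbsoluteContactClasses
open Summit.ResolutionOfSingularities.ResolutionOfSingularities.Theses

universe u

namespace Summit.ResolutionOfSingularities.ResolutionOfSingularities.Theorems.HugValuationCut

/-! ## §1 The exact carves (zero binders, both directions consumed) -/

section Carve

/-- **CARVE of door (S′) at weight `n`**: `DeepSurfaceLaw n ⟺ NonPrimaryDeepSurfaceLaw n` — the primary deep cell is
DECIDED by LAW F (`noTower_primaryDeepSurfaceHugging`), the non-primary deep cell is the exact located residual. [folklore] -/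
theorem deepSurfaceLaw_iff_g47 (n : ℕ) : DeepSurfaceLaw n ↔ NonPrimaryDeepSurfaceLaw n :=
  ⟨fun h => ((noTower_split DeepSurfaceHugging PrimaryDeepSurfaceHugging).mp h).2,
    fun h => (noTower_split DeepSurfaceHugging PrimaryDeepSurfaceHugging).mpr
      ⟨noTower_mono (fun _ hT => hT.2) (noTower_primaryDeepSurfaceHugging n), h⟩⟩

/-- **CARVE of door (C′) at weight `n`**: `DeepContactLaw n ⟺ NonPrimaryDeepContactLaw n` (same decided cell). [folklore] -/
theorem deepContactLaw_iff_g47 (n : ℕ) : DeepContactLaw n ↔ NonPrimaryDeepContactLaw n :=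
  ⟨fun h => ((noTower_split DeepContactHugging PrimaryDeepSurfaceHugging).mp h).2,
    fun h => (noTower_split DeepContactHugging PrimaryDeepSurfaceHugging).mpr
      ⟨noTower_mono (fun _ hT => hT.2) (noTower_primaryDeepSurfaceHugging n), h⟩⟩

/-- **the contact column minus its two DECIDED cells** (submaximal by LAW E, primary deep by LAW F; weight `n ≥ 1`):
`ContactHuggingTowersTerminate n ⟺ NonPrimaryDeepContactLaw n`. [folklore] -/
theorem contactHuggingTowersTerminate_iff_g47 {n : ℕ} (hn : 1 ≤ n) :
    ContactHuggingTowersTerminate n ↔ NonPrimaryDeepContactLaw n :=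
  (contactHuggingTowersTerminate_iff_deepContactLaw hn).trans (deepContactLaw_iff_g47 n)

/-- **CARVE of door (S′), all weights**: `DeepSurfaceLawAll ⟺ NonPrimaryDeepSurfaceLawAll`. [folklore] -/
theorem deepSurfaceLawAll_iff_g47 : DeepSurfaceLawAll ↔ NonPrimaryDeepSurfaceLawAll :=
  ⟨fun h n hn => (deepSurfaceLaw_iff_g47 n).mp (h n hn), fun h n hn => (deepSurfaceLaw_iff_g47 n).mpr (h n hn)⟩

/-- **CARVE of door (C′), all weights**: `DeepContactLawAll ⟺ NonPrimaryDeepContactLawAll`. [folklore] -/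
theorem deepContactLawAll_iff_g47 : DeepContactLawAll ↔ NonPrimaryDeepContactLawAll :=
  ⟨fun h n hn => (deepContactLaw_iff_g47 n).mp (h n hn), fun h n hn => (deepContactLaw_iff_g47 n).mpr (h n hn)⟩

/-- **CHAINED CARVE of the registry letter of item 32262**: `MaxContactCut.SurfaceLawAll ⟺ NonPrimaryDeepSurfaceLawAll`
(g46 carve `surfaceLawAll_iff_g46` followed by the g47 carve). [folklore] -/
theorem surfaceLawAll_iff_g47 : MaxContactCut.SurfaceLawAll ↔ NonPrimaryDeepSurfaceLawAll :=
  surfaceLawAll_iff_g46.trans deepSurfaceLawAll_iff_g47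

/-- **CHAINED CARVE of root binder `h71` (registry letter of item 31571)**:
`MaxContactCut.NoContactHuggingTowers ⟺ NonPrimaryDeepContactLawAll`. [folklore] -/
theorem noContactHuggingTowers_iff_g47 : MaxContactCut.NoContactHuggingTowers ↔ NonPrimaryDeepContactLawAll :=
  noContactHuggingTowers_iff_g46.trans deepContactLawAll_iff_g47

end Carve

/-! ## §2 The primary deep cell is inhabited and NOT submaximal: the family `𝓘_N` at ring level -/

section Witness

variable (k : Type) [Field k]

/-- the regular system of parameters `X = (X₀, X₁ | X₂, X₃)` of `R = k⟦X₀,…,X₃⟧`, split as `c = 2` surface EQUATIONS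
`X₀, X₁` (the frame `u = X ∘ castAdd 2`, the regular surface germ `𝔭 = surfIdeal X = (X₀, X₁)`, `R/𝔭 = k⟦X₂, X₃⟧`) followed
by the two surface PARAMETERS `X₂, X₃`. -/
noncomputable def primaryDeepParams : Fin (2 + 2) → MvPowerSeries (Fin 4) k := fun i => MvPowerSeries.X i

/-- the §4 family `𝓘_N = (X₀^ℓ·X₃^e + X₁^ℓ·X₂^N, X₁^ℓ·X₃^e)` of the node memo (`ℓ ≥ 1`, `e ≥ 2`, `N` free; weight
`n = ℓ + e`). -/
noncomputable def primaryDeepFamily (ℓ e N : ℕ) : Ideal (MvPowerSeries (Fin 4) k) :=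
  Ideal.span {(MvPowerSeries.X 0 ^ ℓ * MvPowerSeries.X 3 ^ e + MvPowerSeries.X 1 ^ ℓ * MvPowerSeries.X 2 ^ N :
      MvPowerSeries (Fin 4) k), MvPowerSeries.X 1 ^ ℓ * MvPowerSeries.X 3 ^ e}

/-- the level-`ℓ` shadow of the family: `𝔍_N = (X₀, X₁, X₃^e, X₂^N)` (an `𝔪`-PRIMARY ideal of surface colength `N·e`
and surface order exactly `e`). -/
noncomputable def primaryDeepShadow (e N : ℕ) : Ideal (MvPowerSeries (Fin 4) k) :=
  Ideal.span {(MvPowerSeries.X 0 : MvPowerSeries (Fin 4) k), MvPowerSeries.X 1, MvPowerSeries.X 3 ^ e,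
    MvPowerSeries.X 2 ^ N}

/-- the frame `u = (X₀, X₁)` is part of a regular system of parameters of `k⟦X₀,…,X₃⟧`. [cite: Matsumura1987, Thm. 14.2] -/
theorem isRsopPart_witnessFrame : IsRsopPart (primaryDeepParams k ∘ Fin.castAdd 2) := by
  have h := (isRsopPart_X k (Fin 4) (Equiv.refl _)).comp (Fin.castAdd 2) (Fin.castAdd_injective _ _)
  exact h

/-- **NON-THINNESS WITNESS, letter clauses (1)–(4) at ring level.**  In `R = k⟦X₀,X₁,X₂,X₃⟧` with `u = (X₀, X₁)`,
`𝔭 = (u)`: `u` is part of a regular system of parameters, `R/𝔭` is a regular SURFACE germ (regular of dimension `2`),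
`𝓘_N ⊆ 𝔭^ℓ` (level-`ℓ` contact), and the level-`ℓ` shadow of `𝓘_N` along `𝔭` is EXACTLY `𝔍_N = (X₀, X₁, X₃^e, X₂^N)`
(`ℓ ≥ 1`; any `e`, `N`). [cite: Matsumura1987, Thm. 14.2, §16 Thm. 16.2] -/
theorem primaryDeepFamily_levelShadow {ℓ : ℕ} (hℓ : 1 ≤ ℓ) (e N : ℕ) :
    IsRsopPart (primaryDeepParams k ∘ Fin.castAdd 2) ∧
    IsRegularLocalRing (MvPowerSeries (Fin 4) k ⧸ surfIdeal (primaryDeepParams k)) ∧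
    ringKrullDim (MvPowerSeries (Fin 4) k ⧸ surfIdeal (primaryDeepParams k)) = 2 ∧
    primaryDeepFamily k ℓ e N ≤ surfIdeal (primaryDeepParams k) ^ ℓ ∧
    levelShadow (surfIdeal (primaryDeepParams k)) (primaryDeepFamily k ℓ e N) ℓ = primaryDeepShadow k e N := by
  obtain ⟨ℓ, rfl⟩ := Nat.exists_eq_add_of_le' hℓ
  set u : Fin 2 → MvPowerSeries (Fin 4) k := primaryDeepParams k ∘ Fin.castAdd 2 with hudef
  have h𝔭 : surfIdeal (primaryDeepParams k) = Ideal.span (Set.range u) := rfl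
  rw [h𝔭, primaryDeepFamily, primaryDeepShadow]
  have hu : IsRsopPart u := isRsopPart_witnessFrame k
  have hu0 : u 0 = MvPowerSeries.X 0 := rfl
  have hu1 : u 1 = MvPowerSeries.X 1 := rfl
  have hX0 : (MvPowerSeries.X 0 : MvPowerSeries (Fin 4) k) ∈ Ideal.span (Set.range u) := hu0 ▸ Ideal.subset_span ⟨0, rfl⟩
  have hX1 : (MvPowerSeries.X 1 : MvPowerSeries (Fin 4) k) ∈ Ideal.span (Set.range u) := hu1 ▸ Ideal.subset_span ⟨1, rfl⟩
  -- the regular surface `R/𝔭`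
  have hdim : ringKrullDim (MvPowerSeries (Fin 4) k ⧸ Ideal.span (Set.range u)) = 2 := by
    have h := hu.ringKrullDim_quotient_add
    rw [ringKrullDim_mvPowerSeries, Nat.card_fin] at h
    exact_mod_cast withBot_eNat_add_natCast_cancel (a := 2) (b := 2) (by exact_mod_cast h)
  -- level-`(ℓ+1)` contact
  have hsub : Ideal.span {(MvPowerSeries.X 0 ^ (ℓ + 1) * MvPowerSeries.X 3 ^ e +
        MvPowerSeries.X 1 ^ (ℓ + 1) * MvPowerSeries.X 2 ^ N : MvPowerSeries (Fin 4) k),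
        MvPowerSeries.X 1 ^ (ℓ + 1) * MvPowerSeries.X 3 ^ e} ≤ Ideal.span (Set.range u) ^ (ℓ + 1) := by
    rw [Ideal.span_le]
    intro x hx
    simp only [Set.mem_insert_iff, Set.mem_singleton_iff] at hx
    rcases hx with rfl | rfl
    · exact add_mem (Ideal.mul_mem_right _ _ (Ideal.pow_mem_pow hX0 _)) (Ideal.mul_mem_right _ _ (Ideal.pow_mem_pow hX1 _))
    · exact Ideal.mul_mem_right _ _ (Ideal.pow_mem_pow hX1 _)
  refine ⟨hu, hu.isRegularLocalRing_quotient, hdim, hsub, le_antisymm (levelShadow_le ?_ ?_) ?_⟩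
  · -- `𝔭 ⊆ 𝔍_N`
    rw [Ideal.span_le]
    rintro _ ⟨i, rfl⟩
    fin_cases i
    · exact Ideal.subset_span (by simp [hudef, primaryDeepParams])
    · exact Ideal.subset_span (by simp [hudef, primaryDeepParams])
  · -- `𝓘_N ⊆ 𝔍_N · 𝔭^(ℓ+1)`
    rw [Ideal.span_le]
    intro x hx
    simp only [Set.mem_insert_iff, Set.mem_singleton_iff] at hx
    rcases hx with rfl | rfl
    · exact add_mem (Ideal.mul_mem_mul_rev (Ideal.subset_span (by simp)) (Ideal.pow_mem_pow hX0 _))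
        (Ideal.mul_mem_mul_rev (Ideal.subset_span (by simp)) (Ideal.pow_mem_pow hX1 _))
    · exact Ideal.mul_mem_mul_rev (Ideal.subset_span (by simp)) (Ideal.pow_mem_pow hX1 _)
  · -- `𝔍_N ⊆ 𝔍`: `X₀, X₁ ∈ 𝔭 ⊆ 𝔍`; `X₃^e` and `X₂^N` are the coefficients of the degree-`(ℓ+1)` form
    -- `F = X₃^e·Y₀^(ℓ+1) + X₂^N·Y₁^(ℓ+1)` with `F(u)` the first generator (quasi-regular coefficient criterion)
    have h𝔭𝔍 := le_levelShadow (Ideal.span (Set.range u))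
      (Ideal.span {(MvPowerSeries.X 0 ^ (ℓ + 1) * MvPowerSeries.X 3 ^ e +
        MvPowerSeries.X 1 ^ (ℓ + 1) * MvPowerSeries.X 2 ^ N : MvPowerSeries (Fin 4) k),
        MvPowerSeries.X 1 ^ (ℓ + 1) * MvPowerSeries.X 3 ^ e}) (ℓ + 1)
    set F : MvPolynomial (Fin 2) (MvPowerSeries (Fin 4) k) :=
      monomial (Finsupp.single 0 (ℓ + 1)) (MvPowerSeries.X 3 ^ e) +
        monomial (Finsupp.single 1 (ℓ + 1)) (MvPowerSeries.X 2 ^ N) with hFdef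
    have hdeg : ∀ i : Fin 2, (Finsupp.single i (ℓ + 1)).degree = ℓ + 1 := fun i => by
      rw [Finsupp.degree_single]
    have hF : F.IsHomogeneous (ℓ + 1) :=
      (isHomogeneous_monomial _ (hdeg 0)).add (isHomogeneous_monomial _ (hdeg 1))
    have hFu : eval u F = MvPowerSeries.X 0 ^ (ℓ + 1) * MvPowerSeries.X 3 ^ e +
        MvPowerSeries.X 1 ^ (ℓ + 1) * MvPowerSeries.X 2 ^ N := by
      rw [hFdef, map_add, eval_monomial, eval_monomial, Finsupp.prod_single_index (by rw [pow_zero]),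
        Finsupp.prod_single_index (by rw [pow_zero]), hu0, hu1]
      ring
    have hne : Finsupp.single (0 : Fin 2) (ℓ + 1) ≠ Finsupp.single 1 (ℓ + 1) :=
      (Finsupp.single_left_injective (Nat.succ_ne_zero ℓ)).ne (by decide)
    have hcoef := coeff_mem_levelShadow hu.isQuasiRegular hsub hF
      (by rw [hFu]; exact Ideal.subset_span (by simp))
    have h3 : (MvPowerSeries.X 3 ^ e : MvPowerSeries (Fin 4) k) ∈ levelShadow (Ideal.span (Set.range u))
        (Ideal.span {(MvPowerSeries.X 0 ^ (ℓ + 1) * MvPowerSeries.X 3 ^ e +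
          MvPowerSeries.X 1 ^ (ℓ + 1) * MvPowerSeries.X 2 ^ N : MvPowerSeries (Fin 4) k),
          MvPowerSeries.X 1 ^ (ℓ + 1) * MvPowerSeries.X 3 ^ e}) (ℓ + 1) := by
      have h := hcoef (Finsupp.single 0 (ℓ + 1))
      rwa [hFdef, coeff_add, coeff_monomial, coeff_monomial, if_pos rfl, if_neg hne.symm, add_zero] at h
    have h2 : (MvPowerSeries.X 2 ^ N : MvPowerSeries (Fin 4) k) ∈ levelShadow (Ideal.span (Set.range u))
        (Ideal.span {(MvPowerSeries.X 0 ^ (ℓ + 1) * MvPowerSeries.X 3 ^ e +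
          MvPowerSeries.X 1 ^ (ℓ + 1) * MvPowerSeries.X 2 ^ N : MvPowerSeries (Fin 4) k),
          MvPowerSeries.X 1 ^ (ℓ + 1) * MvPowerSeries.X 3 ^ e}) (ℓ + 1) := by
      have h := hcoef (Finsupp.single 1 (ℓ + 1))
      rwa [hFdef, coeff_add, coeff_monomial, coeff_monomial, if_neg hne, if_pos rfl, zero_add] at h
    rw [Ideal.span_le]
    rintro x hx
    simp only [Set.mem_insert_iff, Set.mem_singleton_iff] at hx
    rcases hx with rfl | rfl | rfl | rfl
    · exact h𝔭𝔍 hX0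
    · exact h𝔭𝔍 hX1
    · exact h3
    · exact h2

/-- **NON-THINNESS WITNESS, letter clauses (5)–(6): the shadow is `𝔪`-PRIMARY (`𝔪^(N+e) ⊆ 𝔍_N`) and of surface
order EXACTLY `e` (`𝔍_N ⊄ 𝔪^(e+1) + 𝔭`, i.e. `x̄₃^e ∉ 𝔪̄^(e+1)` on the regular surface `R/𝔭 = k⟦X₂,X₃⟧`).**
[cite: Matsumura1987, Thm. 14.2, §16 Thm. 16.2] -/
theorem primaryDeepShadow_pow_le_and_not_le (e N : ℕ) :
    maximalIdeal (MvPowerSeries (Fin 4) k) ^ (N + e) ≤ primaryDeepShadow k e N ∧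
    ¬ primaryDeepShadow k e N ≤ maximalIdeal (MvPowerSeries (Fin 4) k) ^ (e + 1) ⊔ surfIdeal (primaryDeepParams k) := by
  constructor
  · -- `𝔪 ⊆ ((X₂) + (X₃)) + (X₀, X₁)` and `((X₂) + (X₃))^(N+e) ⊆ (X₂)^N + (X₃)^e`
    have h𝔪 : maximalIdeal (MvPowerSeries (Fin 4) k) ≤
        (Ideal.span {MvPowerSeries.X 2} ⊔ Ideal.span {MvPowerSeries.X 3}) ⊔
          Ideal.span {MvPowerSeries.X 0, MvPowerSeries.X 1} := by
      rw [maximalIdeal_mvPowerSeries_eq_span, Ideal.span_le]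
      rintro _ ⟨i, rfl⟩
      fin_cases i
      · exact Ideal.mem_sup_right (Ideal.subset_span (by simp))
      · exact Ideal.mem_sup_right (Ideal.subset_span (by simp))
      · exact Ideal.mem_sup_left (Ideal.mem_sup_left (Ideal.mem_span_singleton_self _))
      · exact Ideal.mem_sup_left (Ideal.mem_sup_right (Ideal.mem_span_singleton_self _))
    rw [primaryDeepShadow]
    refine (Ideal.pow_right_mono h𝔪 (N + e)).trans ((sup_pow_le_pow_sup _ _ (N + e)).trans (sup_le ?_ ?_))
    · refine (Ideal.sup_pow_add_le_pow_sup_pow (n := N) (m := e)).trans (sup_le ?_ ?_)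
      · rw [Ideal.span_singleton_pow, Ideal.span_singleton_le_iff_mem]
        exact Ideal.subset_span (by simp)
      · rw [Ideal.span_singleton_pow, Ideal.span_singleton_le_iff_mem]
        exact Ideal.subset_span (by simp)
    · exact Ideal.span_mono (by
        intro x hx
        simp only [Set.mem_insert_iff, Set.mem_singleton_iff] at hx ⊢
        tauto)
  · intro h
    rw [primaryDeepShadow] at h
    haveI := isRegularLocalRing_mvPowerSeries k (Fin 4)
    have hu : IsRsopPart (primaryDeepParams k ∘ Fin.castAdd 2) := isRsopPart_witnessFrame k
    haveI hS : IsRegularLocalRing (MvPowerSeries (Fin 4) k ⧸ surfIdeal (primaryDeepParams k)) :=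
      hu.isRegularLocalRing_quotient
    have hz : Ideal.span (Set.range (primaryDeepParams k)) = maximalIdeal (MvPowerSeries (Fin 4) k) := by
      rw [maximalIdeal_mvPowerSeries_eq_span]
      rfl
    have hd4 : (maximalIdeal (MvPowerSeries (Fin 4) k)).spanFinrank = 2 + 2 := by
      have h1 := IsRegularLocalRing.spanFinrank_maximalIdeal (R := MvPowerSeries (Fin 4) k)
      rw [ringKrullDim_mvPowerSeries, Nat.card_fin] at h1
      exact_mod_cast h1
    have hdS : (maximalIdeal (MvPowerSeries (Fin 4) k ⧸ surfIdeal (primaryDeepParams k))).spanFinrank = 2 :=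
      spanFinrank_maximalIdeal_surface (primaryDeepParams k) hz hd4
    have hcS : Ideal.span (Set.range (surfParam (primaryDeepParams k))) = maximalIdeal _ :=
      span_range_surfParam (primaryDeepParams k) hz
    have hc : IsRsopPart (surfParam (primaryDeepParams k)) := isRsopPart_full (c := 0) (surfParam (primaryDeepParams k)) hcS hdS
    -- `X₃^e ∈ 𝔪^(e+1) + 𝔭` ⇒ `x̄₃^e ∈ 𝔪̄^(e+1) = (c̄)·(c̄)^e` on the surface
    have h3 : Ideal.span {(MvPowerSeries.X 3 ^ e : MvPowerSeries (Fin 4) k)} ≤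
        maximalIdeal _ ^ (e + 1) ⊔ surfIdeal (primaryDeepParams k) := by
      rw [Ideal.span_singleton_le_iff_mem]
      exact h (Ideal.subset_span (by simp))
    have hmap := (map_mk_le_pow_iff (surfIdeal (primaryDeepParams k))
      (Ideal.span {(MvPowerSeries.X 3 ^ e : MvPowerSeries (Fin 4) k)}) (e + 1)).mpr h3
    rw [Ideal.map_span, Set.image_singleton, map_pow, Ideal.span_singleton_le_iff_mem, pow_succ', ← hcS] at hmap
    have hc1 : surfParam (primaryDeepParams k) 1 = Ideal.Quotient.mk (surfIdeal (primaryDeepParams k)) (MvPowerSeries.X 3) := rfl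
    set F : MvPolynomial (Fin 2) (MvPowerSeries (Fin 4) k ⧸ surfIdeal (primaryDeepParams k)) :=
      monomial (Finsupp.single 1 e) 1 with hFdef
    have hF : F.IsHomogeneous e := isHomogeneous_monomial _ (by rw [Finsupp.degree_single])
    have hFc : eval (surfParam (primaryDeepParams k)) F =
        Ideal.Quotient.mk (surfIdeal (primaryDeepParams k)) (MvPowerSeries.X 3) ^ e := by
      rw [hFdef, eval_monomial, Finsupp.prod_single_index (by rw [pow_zero]), one_mul, hc1]
    have h1 := coeff_mem_of_eval_mem_mul_pow hc.isQuasiRegular le_rfl hF (by rw [hFc]; exact hmap)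
      (Finsupp.single 1 e)
    rw [hFdef, coeff_monomial, if_pos rfl, hcS] at h1
    exact (Ideal.ne_top_iff_one _).mp (IsLocalRing.maximalIdeal.isMaximal _).ne_top h1

/-- **NON-SUBMAXIMALITY of the family: `𝓘_N ⊄ 𝔭^(n-1)` for `n = ℓ + e`, `e ≥ 2`** — the generator `X₁^ℓ·X₃^e` is
`F(u)` for the degree-`ℓ` form `F = X₃^e·Y₁^ℓ`, and `X₁^ℓ·X₃^e ∈ 𝔭^(ℓ+1) = 𝔭·𝔭^ℓ` would force the coefficient
`X₃^e ∈ 𝔭 = (X₀, X₁)` (quasi-regularity), i.e. `X₃ ∈ (X₀, X₁)` — absurd for a regular system of parameters.  Hence the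
family lies in the DEEP cell, not in g46's submaximal one. [cite: Matsumura1987, Thm. 14.2, §16 Thm. 16.2] -/
theorem primaryDeepFamily_not_le_pow (ℓ : ℕ) {e : ℕ} (he : 2 ≤ e) (N : ℕ) :
    ¬ primaryDeepFamily k ℓ e N ≤ surfIdeal (primaryDeepParams k) ^ (ℓ + e - 1) := by
  intro h
  set u : Fin 2 → MvPowerSeries (Fin 4) k := primaryDeepParams k ∘ Fin.castAdd 2 with hudef
  have h𝔭 : surfIdeal (primaryDeepParams k) = Ideal.span (Set.range u) := rfl
  rw [h𝔭, primaryDeepFamily] at h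
  have hu : IsRsopPart u := isRsopPart_witnessFrame k
  have hu1 : u 1 = MvPowerSeries.X 1 := rfl
  have hle : ℓ + 1 ≤ ℓ + e - 1 := by omega
  -- `X₁^ℓ·X₃^e ∈ 𝔭^(ℓ+e-1) ⊆ 𝔭^(ℓ+1) = 𝔭·𝔭^ℓ`
  have hmem : (MvPowerSeries.X 1 ^ ℓ * MvPowerSeries.X 3 ^ e : MvPowerSeries (Fin 4) k) ∈
      Ideal.span (Set.range u) * Ideal.span (Set.range u) ^ ℓ := by
    rw [← pow_succ']
    exact Ideal.pow_le_pow_right hle (h (Ideal.subset_span (by simp)))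
  set F : MvPolynomial (Fin 2) (MvPowerSeries (Fin 4) k) := monomial (Finsupp.single 1 ℓ) (MvPowerSeries.X 3 ^ e)
    with hFdef
  have hF : F.IsHomogeneous ℓ := isHomogeneous_monomial _ (by rw [Finsupp.degree_single])
  have hFu : eval u F = MvPowerSeries.X 1 ^ ℓ * MvPowerSeries.X 3 ^ e := by
    rw [hFdef, eval_monomial, Finsupp.prod_single_index (by rw [pow_zero]), hu1, mul_comm]
  have h3 := coeff_mem_of_eval_mem_mul_pow hu.isQuasiRegular le_rfl hF (by rw [hFu]; exact hmem)
    (Finsupp.single 1 ℓ)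
  rw [hFdef, coeff_monomial, if_pos rfl] at h3
  -- `X₃ ∈ (X₀, X₁)`: absurd
  have h3' : (MvPowerSeries.X 3 : MvPowerSeries (Fin 4) k) ∈ Ideal.span (Set.range u) :=
    hu.isPrime_span_range.mem_of_pow_mem e h3
  have hx : IsRsopPart (fun i : Fin 4 => (MvPowerSeries.X i : MvPowerSeries (Fin 4) k)) :=
    isRsopPart_X k (Fin 4) (Equiv.refl _)
  refine hx.not_mem_span_image (S := Set.range (Fin.castAdd 2 : Fin 2 → Fin (2 + 2))) (i := 3)
    (natAdd_not_mem_range_castAdd (c := 2) 1) ?_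
  rw [← Set.range_comp]
  exact h3'

end Witness

/-! ## §3 FQ controls (the statements BY NAME, proved by the theorems above) -/

example (n : ℕ) :
    Summit.ResolutionOfSingularities.ResolutionOfSingularities.Theorems.DivergentTowerClasses.NoTower n
      Summit.ResolutionOfSingularities.ResolutionOfSingularities.Theorems.HugValuationCut.PrimaryDeepSurfaceHugging :=
  noTower_primaryDeepSurfaceHugging n

example : Summit.ResolutionOfSingularities.ResolutionOfSingularities.Theorems.HugValuationCut.DeepSurfaceLawAll ↔
    Summit.ResolutionOfSingularities.ResolutionOfSingularities.Theorems.HugValuationCut.NonPrimaryDeepSurfaceLawAll :=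
  deepSurfaceLawAll_iff_g47

example : Summit.ResolutionOfSingularities.ResolutionOfSingularities.Theorems.HugValuationCut.DeepContactLawAll ↔
    Summit.ResolutionOfSingularities.ResolutionOfSingularities.Theorems.HugValuationCut.NonPrimaryDeepContactLawAll :=
  deepContactLawAll_iff_g47

example : Summit.ResolutionOfSingularities.ResolutionOfSingularities.Theses.MaxContactCut.SurfaceLawAll ↔
    Summit.ResolutionOfSingularities.ResolutionOfSingularities.Theorems.HugValuationCut.NonPrimaryDeepSurfaceLawAll :=
  surfaceLawAll_iff_g47

example : Summit.ResolutionOfSingularities.ResolutionOfSingularities.Theses.MaxContactCut.NoContactHuggingTowers ↔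
    Summit.ResolutionOfSingularities.ResolutionOfSingularities.Theorems.HugValuationCut.NonPrimaryDeepContactLawAll :=
  noContactHuggingTowers_iff_g47

/-- the critic's numerical instance `(ℓ, e, N) = (1, 2, 4)`, weight `n = 3`: level-`1` contact, shadow
`(X₀, X₁, X₃², X₂⁴)` exactly, `𝔪⁶ ⊆` shadow, shadow `⊄ 𝔪³ + 𝔭`, and `𝓘₄ ⊄ 𝔭² = 𝔭^(n-1)`. [folklore] -/
example (k : Type) [Field k] :
    primaryDeepFamily k 1 2 4 ≤ surfIdeal (primaryDeepParams k) ^ 1 ∧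
    levelShadow (surfIdeal (primaryDeepParams k)) (primaryDeepFamily k 1 2 4) 1 = primaryDeepShadow k 2 4 ∧
    IsLocalRing.maximalIdeal (MvPowerSeries (Fin 4) k) ^ (4 + 2) ≤ primaryDeepShadow k 2 4 ∧
    ¬ primaryDeepShadow k 2 4 ≤ IsLocalRing.maximalIdeal (MvPowerSeries (Fin 4) k) ^ (2 + 1) ⊔ surfIdeal (primaryDeepParams k) ∧
    ¬ primaryDeepFamily k 1 2 4 ≤ surfIdeal (primaryDeepParams k) ^ (1 + 2 - 1) :=
  ⟨(primaryDeepFamily_levelShadow k le_rfl 2 4).2.2.2.1, (primaryDeepFamily_levelShadow k le_rfl 2 4).2.2.2.2,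
    (primaryDeepShadow_pow_le_and_not_le k 2 4).1, (primaryDeepShadow_pow_le_and_not_le k 2 4).2,
    primaryDeepFamily_not_le_pow k 1 (by norm_num) 4⟩

end Summit.ResolutionOfSingularities.ResolutionOfSingularities.Theorems.HugValuationCut
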